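import Summits.RiemannHypothesis.RiemannHypothesis.Theorems.WeilTwoPrimeDeflE72Base
import Literature.NumberTheory.LFunctions.WeilBlockRowsFast
import HarnessLib

/-!
# Deflated two-prime certificate (weilCertDeflE72): the Bessel block claim `Hp = C H Cᵀ` (parity 0), rows 50–54, fast check

`WeilCert.checkHpRowT` (linear traversals) instead of the indexed `checkHpRow` decide.  Pure proof file.
-/

noncomputable section

namespace Summit.RiemannHypothesis.RiemannHypothesis.Theorems.EvenWinsBeyondArch

open Literature.NumberTheory.LFunctions

set_option maxHeartbeats 0 in
/-- Fast kernel check of claim row 50 of `Hp = C H Cᵀ` (parity 0; linear traversals, triangular `C`). [folklore] -/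
theorem checkHpRowT0_50_weilCertDeflE72 : weilCertDeflE72Base.checkHpRowT weilCertDeflE72HpE 0 50 = true := by
  decide +kernel

/-- Claim row 50 of `Hp = C H Cᵀ` (parity 0), from the fast check. [folklore] -/
theorem checkHpRow0_50_weilCertDeflE72 : weilCertDeflE72Base.checkHpRow weilCertDeflE72HpE 0 50 = true :=
  WeilCert.checkHpRow_of_T checkHpRowT0_50_weilCertDeflE72

set_option maxHeartbeats 0 in
/-- Fast kernel check of claim row 51 of `Hp = C H Cᵀ` (parity 0; linear traversals, triangular `C`). [folklore] -/
theorem checkHpRowT0_51_weilCertDeflE72 : weilCertDeflE72Base.checkHpRowT weilCertDeflE72HpE 0 51 = true := by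
  decide +kernel

/-- Claim row 51 of `Hp = C H Cᵀ` (parity 0), from the fast check. [folklore] -/
theorem checkHpRow0_51_weilCertDeflE72 : weilCertDeflE72Base.checkHpRow weilCertDeflE72HpE 0 51 = true :=
  WeilCert.checkHpRow_of_T checkHpRowT0_51_weilCertDeflE72

set_option maxHeartbeats 0 in
/-- Fast kernel check of claim row 52 of `Hp = C H Cᵀ` (parity 0; linear traversals, triangular `C`). [folklore] -/
theorem checkHpRowT0_52_weilCertDeflE72 : weilCertDeflE72Base.checkHpRowT weilCertDeflE72HpE 0 52 = true := by
  decide +kernel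

/-- Claim row 52 of `Hp = C H Cᵀ` (parity 0), from the fast check. [folklore] -/
theorem checkHpRow0_52_weilCertDeflE72 : weilCertDeflE72Base.checkHpRow weilCertDeflE72HpE 0 52 = true :=
  WeilCert.checkHpRow_of_T checkHpRowT0_52_weilCertDeflE72

set_option maxHeartbeats 0 in
/-- Fast kernel check of claim row 53 of `Hp = C H Cᵀ` (parity 0; linear traversals, triangular `C`). [folklore] -/
theorem checkHpRowT0_53_weilCertDeflE72 : weilCertDeflE72Base.checkHpRowT weilCertDeflE72HpE 0 53 = true := by
  decide +kernel

/-- Claim row 53 of `Hp = C H Cᵀ` (parity 0), from the fast check. [folklore] -/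
theorem checkHpRow0_53_weilCertDeflE72 : weilCertDeflE72Base.checkHpRow weilCertDeflE72HpE 0 53 = true :=
  WeilCert.checkHpRow_of_T checkHpRowT0_53_weilCertDeflE72

set_option maxHeartbeats 0 in
/-- Fast kernel check of claim row 54 of `Hp = C H Cᵀ` (parity 0; linear traversals, triangular `C`). [folklore] -/
theorem checkHpRowT0_54_weilCertDeflE72 : weilCertDeflE72Base.checkHpRowT weilCertDeflE72HpE 0 54 = true := by
  decide +kernel

/-- Claim row 54 of `Hp = C H Cᵀ` (parity 0), from the fast check. [folklore] -/
theorem checkHpRow0_54_weilCertDeflE72 : weilCertDeflE72Base.checkHpRow weilCertDeflE72HpE 0 54 = true :=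
  WeilCert.checkHpRow_of_T checkHpRowT0_54_weilCertDeflE72

end Summit.RiemannHypothesis.RiemannHypothesis.Theorems.EvenWinsBeyondArch
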